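import Summits.QuantumFields.YangMills.Theorems.QuantileBitPurityFluxNumerics
import Summits.QuantumFields.YangMills.Theorems.QuantileBitPurityFluxReflectionForm
import Summits.QuantumFields.YangMills.Theorems.ToronSmallBallOwnAxisShiftWindowGen
import HarnessLib

/-!
# The WIDE equator band `{polDist ≥ 2 − β^(−γ)}` is negligible in every seam sector without `x`-twist, on the window `L ≤ β^(γ/40)`

Support module (`--supports` stmt-QuantumFields-24093, `QuantileBitPurity.EquatorBandVanishing`; seat ym-dw-p1 g17).  The tree's own-axis strip estimate
`OwnAxis.sectorWeight_stripGen_le_rpow_of_numerics` AT THE EQUATOR (`f ≡ 2`, core radius `c₀ = 1`, floor `σ = 1/4`: the holonomy axis is perfectly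
conditioned there, so angular translates as large as `β^(−γ)` are cheap), fed with the WIDE parameter set `OwnAxis.numericsWide`
(`η = β^(−(1/2 − γ/4))`, `K = ⌈64eβ^(γ/40)⌉₊` translates of step `6β^(−γ)`):

★ `sectorWeight_wideBand_le_rpow`: for every `0 < γ ≤ 2/5` there is `β₀` with
`W_z(𝟙{2 − β^(−γ) ≤ polDist U₀}) ≤ β^(−γ/40) · Z_phys(n+1)` for `β ≥ β₀`, `1 ≤ L ≤ β^(γ/40)`, `1 ≤ n`, `n+1 ≤ 2L`, every `z` with `z 0 = false`.

HONEST FRAMING: fixed-lattice estimate on a window; nothing about infinite volume, the continuum limit or the Clay gap.  No `sorry`, no new axiom, no new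
definition.  References: [cite: Luscher1983, §2]; [cite: tHooft1979]; [cite: MontvayMunster1994, (3.145)].
-/

set_option autoImplicit false

noncomputable section

open MeasureTheory Filter Topology Real Function Set
open scoped BigOperators
open Literature.MathematicalPhysics.QuantumLattice
open Literature.MathematicalPhysics.QuantumFieldTheory hiding SU2
open Summit.QuantumFields.YangMills.Theorems

namespace Summit.QuantumFields.YangMills.Theorems.FemtoTransferGap.Flux

open Summit.QuantumFields.YangMills.Theorems.FemtoTransferGap
open Summit.QuantumFields.YangMills.Theorems.FemtoTransferGap.FlatSheet
open Summit.QuantumFields.YangMills.Theorems.FemtoTransferGap.TT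
open Summit.QuantumFields.YangMills.Theorems.FemtoTransferGap.OwnAxis

variable {L : ℕ} [NeZero L]

omit [NeZero L] in
/-- The wide band lies in the own-axis strip at the equator: `{2 − w ≤ polDist} ⊆ {|polDist − 2| ≤ w, 1 < polDist}` for `w ≤ 1/2`. [folklore] -/
theorem wideBand_indicator_le_strip {w : ℝ} (hw : w ≤ 1 / 2) (U : GaugeConfig 3 L SU2) :
    {U : GaugeConfig 3 L SU2 | 2 - w ≤ polDist U}.indicator (fun _ => (1 : ℝ)) U ≤
      {U : GaugeConfig 3 L SU2 | |polDist U - (fun _ : GaugeConfig 3 L SU2 => (2 : ℝ)) U| ≤ w ∧ 1 < polDist U}.indicator (fun _ => (1 : ℝ)) U := by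
  refine Set.indicator_le_indicator_of_subset (fun V hV => ?_) (fun _ => zero_le_one) U
  have h : 2 - w ≤ polDist V := hV
  have h2 := polDist_le_two V
  refine ⟨?_, by linarith⟩
  show |polDist V - 2| ≤ w
  rw [abs_le]; constructor <;> linarith

set_option maxHeartbeats 800000 in
/-- ★ **The wide equator band is negligible in every sector without `x`-twist.** [cite: Luscher1983, §2] [cite: tHooft1979] -/
theorem sectorWeight_wideBand_le_rpow {γ : ℝ} (hγ : 0 < γ) (hγ' : γ ≤ 2 / 5) :
    ∃ β₀ : ℝ, ∀ β : ℝ, β₀ ≤ β → ∀ (L : ℕ) [NeZero L], (L : ℝ) ≤ β ^ (γ / 40) → ∀ n : ℕ, 1 ≤ n → n + 1 ≤ 2 * L →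
      ∀ z : Fin 3 → Bool, z 0 = false →
        sectorWeight (L := L) β n z (fun Us _ => {U : GaugeConfig 3 L SU2 | 2 - β ^ (-γ) ≤ polDist U}.indicator (fun _ => (1 : ℝ)) (Us 0)) ≤
          β ^ (-(γ / 40)) * physTraceSucc L β n := by
  obtain ⟨β₀, hnum⟩ := numericsWide hγ hγ'
  refine ⟨β₀, fun β hβ L _ hLa n hn1 hn2 z hz => ?_⟩
  have hL1 : 1 ≤ L := NeZero.one_le
  obtain ⟨h200, hη, h32, hK1, hβη, hmaster, hG, hKa, hw, hw2⟩ := hnum β hβ L hL1 hLa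
  have hL1r : (1 : ℝ) ≤ L := by exact_mod_cast hL1
  obtain ⟨hfl, -⟩ := floor_of_small (L := L) h32
  have hP0 : 0 ≤ ((⌈64 * Real.exp 1 * β ^ (γ / 40)⌉₊ : ℕ) : ℝ) * (6 * β ^ (-γ)) := by positivity
  obtain ⟨hKσ, hJ, hQ⟩ := shift_jac_cost_of_master (β := β) (L := L) hP0 hβη hL1r hmaster
  have hstrip := sectorWeight_stripGen_le_rpow_of_numerics (L := L) (z := z) hz (f := fun _ => (2 : ℝ)) measurable_const
    (fun _ _ => rfl) hn1 hn2 h200 hη hw (θ' := 6 * β ^ (-γ)) (by linarith) (σ := 1 / 4) (by norm_num) (by norm_num) (c₀ := 1)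
    hfl hK1 hKσ hQ hJ hG hKa
  have mA : Measurable (uncurry fun (Us : Fin (n + 1) → GaugeConfig 3 L SU2) (_g : Site 3 L → SU2) =>
      {U : GaugeConfig 3 L SU2 | 2 - β ^ (-γ) ≤ polDist U}.indicator (fun _ => (1 : ℝ)) (Us 0)) :=
    measurable_uncurry_slice_zero (measurable_const.indicator (measurableSet_le measurable_const measurable_polDist))
  have mS : Measurable (uncurry fun (Us : Fin (n + 1) → GaugeConfig 3 L SU2) (_g : Site 3 L → SU2) =>
      {U : GaugeConfig 3 L SU2 | |polDist U - (fun _ : GaugeConfig 3 L SU2 => (2 : ℝ)) U| ≤ β ^ (-γ) ∧ 1 < polDist U}.indicator (fun _ => (1 : ℝ)) (Us 0)) :=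
    measurable_uncurry_slice_zero (measurable_const.indicator (measurableSet_stripGen measurable_const _ _))
  exact (sectorWeight_mono β n z mA mS (fun Us _ => FluxReflection.abs_ind_le_one _ (Us 0)) (fun Us _ => FluxReflection.abs_ind_le_one _ (Us 0))
    (fun Us _ => wideBand_indicator_le_strip hw2 (Us 0))).trans hstrip

end Summit.QuantumFields.YangMills.Theorems.FemtoTransferGap.Flux

end
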